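import Literature.MathematicalPhysics.QuantumFieldTheory.Balaban1983to89.Setup
import HarnessLib

/-!
# S2β · D-GUARD ∕ (BG∞) — PARITY DESCENT ON THE BLOCK PARTITION OF `ZMod N` ((L-D) of UV3-NODE §116 ADDENDUM 1, binder style per desk RULING №127): closed blocks of the
# partition meet only when consecutive, and then in the one shared boundary residue; around an EVEN cycle consecutive blocks have opposite parity; hence the
# «descent» of a residue from an odd block onto the even neighbour whose boundary it sits on is the SAME from either side — the consistency engine of the sections theorem

Cell `ym3-torus` (YM ladder rung R3 = continuum `SU(2)` Yang–Mills on the three-torus at fixed lattice data — a RUNG: NOT d = 4, NOT infinite volume,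
NOT a mass gap, NOT Clay).  Width seat «width 19» `ym3-torus-px19` (gen 25, ★p1 lineage), FREE px helper on crux `stmt-QuantumFields-20520`
(`FluctuationComparisonRegPrIntL`; registry `Lines/semiclassical_s2beta.lean` UNTOUCHED, 0∕5); `--kind proof --supports stmt-QuantumFields-20520 --as helper`,
count-neutral, DEFINITION-FREE (0 `def`, 0 `instance`, 0 `notation`, 0 `sorry`, default heartbeats).  Binders = block-data text v1 of ✓`…ParityBlockPartition.exists_parityBlocks`
(`len start : Fin M → ℕ`, the three start laws, `1 ≤ len`, `Even M`), ONE axis at a time (the 3-torus statements are coordinatewise conjunctions of these).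

WHY (UV3-NODE §116 ADDENDUM 1, «descent formulation»).  The sections of the 8-colour gluing are closed-form stage terms; their CONSISTENCY on shared sites reduces to ONE
combinatorial fact per axis: if a residue `v` lies in the closed blocks `i` and `i′`, then either `i′ = i`, or the two blocks are CONSECUTIVE and `v` is their shared
boundary (`(v − start i).val = len i`, `(v − start i′).val = 0` or the mirror image) — and consecutive indices on an even cycle have opposite parity, so «replace an ODD
block by the even neighbour across the boundary `v` sits on» gives the same block from `i` and from `i′`.  This file proves exactly these 1-D facts; no descent FUNCTION
is defined (binder style): the successor relation and the descent relation are written out.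

WHAT IS PROVED (sorry-free; `N M : ℕ`, `[NeZero N]`, `len start : Fin M → ℕ`; «`Succ i j`» :≡ `(j:ℕ) = (i:ℕ) + 1 ∨ ((i:ℕ) + 1 = M ∧ (j:ℕ) = 0)`, written out).
* §1 partial sums: `start_add_len_le_start` (`i < i′ ⟹ start i + len i ≤ start i′`), `start_add_len_lt_start` (`i + 2 ≤ i′ ⟹ start i + len i < start i′`, needs `1 ≤ len`),
  `start_add_len_le` (`start i + len i ≤ N`), `start_add_len_lt` (`i + 1 < M ⟹ start i + len i < N`), `start_pos` (`0 < i ⟹ 0 < start i`).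
* §2 ★ `val_sub_natCast_le_iff` — the closed-block reading: for `s < N`, `(v − s).val ≤ ℓ ↔ (s ≤ v.val ∧ v.val ≤ s + ℓ) ∨ v.val + N ≤ s + ℓ`;
  ★ `memClosed_iff` — `(v − start i).val ≤ len i ↔ (start i ≤ v.val ∧ v.val ≤ start i + len i) ∨ ((i:ℕ) + 1 = M ∧ v.val = 0)` (the wrap of the last block).
* §3 ★★★ `adjacent_of_memClosed` (D0) — `v` in closed blocks `i ≠ i′` ⟹ `Succ i i′ ∨ Succ i′ i`; ★★ `boundary_of_succ_memClosed` — `Succ i i′`, `v` in both ⟹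
  `(v − start i).val = len i ∧ (v − start i′).val = 0`.
* §4 ★★ `odd_iff_succ_even` — `Even M`, `Succ i j` ⟹ `((i:ℕ) % 2 = 1 ↔ (j:ℕ) % 2 = 0)` (parity alternates around an even cycle, wrap included);
  ★★★ `descent_agrees` (D2, relational) — if `v` lies in closed blocks `i` and `i′` and `j`, `j′` are their descents (`j` = the even neighbour across the face of `i` that `v`
  sits on when `i` is odd and `v` is on a face, else `j = i`; same for `j′` from `i′`), then `j = j′`.

HONEST SCOPE.  `Fin`∕`ZMod`∕parity bookkeeping; nothing of Bałaban's renormalisation-group analysis is asserted or proved ([Balaban1985RegularSpaces] Lemma 1 p.79 — cube-local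
gauges; the torus-global parity gluing is the (BG∞) plan's, NOT in print).  (BG∞) ∕ `hsupp⁺` is a CONJECTURE (plan §116) and is NOT proved; (L-I)(L-T)(L-S)(L-Σ) are
OPEN; GAP♯∘ (`stub_uniformFibreGapOrbit`, registry UNTOUCHED), the five registered stubs (0∕5), S2β, 20520, 19936, 19200, `YM3TorusSU2` are NOT proved; no registered
stub is closed; rung R3 — NOT d = 4, NOT infinite volume, NOT a mass gap, NOT Clay; the Yang–Mills mass gap is NOT proved.  Axioms standard.

References: T. Bałaban, CMP **99** (1985) 75–102 [Balaban1985RegularSpaces] (Lemma 1 p.79, (1.29) p.81).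
-/

set_option autoImplicit false

namespace Summit.QuantumFields.YangMills.Theorems.FluctuationComparisonRegPrIntLS2BetaParityDescent

variable {M : ℕ}

/-! ## §1 Partial sums of the block lengths -/

section Starts
variable (len start : Fin M → ℕ)
  (hs : ∀ i j : Fin M, (j : ℕ) = (i : ℕ) + 1 → start j = start i + len i)

include hs in
/-- `i < i′ ⟹ start i + len i ≤ start i′` (the starts are the partial sums of the lengths). [folklore] -/
theorem start_add_len_le_start (i i' : Fin M) (h : (i : ℕ) < (i' : ℕ)) : start i + len i ≤ start i' := by
  -- induction on the gap `i′ − i − 1`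
  obtain ⟨d, hd⟩ : ∃ d, (i' : ℕ) = (i : ℕ) + 1 + d := ⟨(i' : ℕ) - (i : ℕ) - 1, by omega⟩
  induction d generalizing i' with
  | zero => exact (hs i i' (by omega)).symm.le
  | succ d ih =>
    have hlt : (i : ℕ) + 1 + d < M := by omega
    have h1 := ih ⟨(i : ℕ) + 1 + d, hlt⟩ (by simp; omega) rfl
    have h2 := hs ⟨(i : ℕ) + 1 + d, hlt⟩ i' (by simp; omega)
    omega

include hs in
/-- `i + 2 ≤ i′ ⟹ start i + len i < start i′` (a whole block of length `≥ 1` lies in between). [folklore] -/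
theorem start_add_len_lt_start (hlen : ∀ i, 1 ≤ len i) (i i' : Fin M) (h : (i : ℕ) + 2 ≤ (i' : ℕ)) : start i + len i < start i' := by
  have hlt : (i : ℕ) + 1 < M := by omega
  have h1 := hs i ⟨(i : ℕ) + 1, hlt⟩ rfl
  have h2 := start_add_len_le_start len start hs ⟨(i : ℕ) + 1, hlt⟩ i' (by simp; omega)
  have h3 := hlen ⟨(i : ℕ) + 1, hlt⟩
  omega

include hs in
/-- `start i + len i ≤ N` (the blocks tile `[0, N)`). [folklore] -/
theorem start_add_len_le {N : ℕ} (hl : ∀ i : Fin M, (i : ℕ) + 1 = M → start i + len i = N) (i : Fin M) : start i + len i ≤ N := by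
  have hM : 0 < M := Fin.pos i
  rcases Nat.lt_or_ge ((i : ℕ) + 1) M with h | h
  · have h1 := start_add_len_le_start len start hs i ⟨M - 1, by omega⟩ (by simp; omega)
    have h2 := hl ⟨M - 1, by omega⟩ (by simp; omega)
    omega
  · exact (hl i (by omega)).le

include hs in
/-- `i + 1 < M ⟹ start i + len i < N`. [folklore] -/
theorem start_add_len_lt {N : ℕ} (hlen : ∀ i, 1 ≤ len i) (hl : ∀ i : Fin M, (i : ℕ) + 1 = M → start i + len i = N) (i : Fin M)
    (h : (i : ℕ) + 1 < M) : start i + len i < N := by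
  have h1 := hs i ⟨(i : ℕ) + 1, h⟩ rfl
  have h2 := start_add_len_le len start hs hl ⟨(i : ℕ) + 1, h⟩
  have h3 := hlen ⟨(i : ℕ) + 1, h⟩
  omega

include hs in
/-- `0 < i ⟹ 0 < start i` (block `0` has length `≥ 1`). [folklore] -/
theorem start_pos (hlen : ∀ i, 1 ≤ len i) (i : Fin M) (h : 0 < (i : ℕ)) : 0 < start i := by
  have hM : 0 < M := Fin.pos i
  have h1 := start_add_len_le_start len start hs ⟨0, hM⟩ i (by simp; omega)
  have h2 := hlen ⟨0, hM⟩
  omega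

end Starts

/-! ## §2 The closed-block reading of `(v − s).val ≤ ℓ` -/

/-- ★ For `s < N`: `(v − s).val ≤ ℓ ↔ (s ≤ v.val ∧ v.val ≤ s + ℓ) ∨ v.val + N ≤ s + ℓ` (the second case is the wrap: `v.val < s`). [folklore] -/
theorem val_sub_natCast_le_iff {N : ℕ} [NeZero N] (v : ZMod N) {s : ℕ} (hs : s < N) (ℓ : ℕ) :
    (v - (s : ZMod N)).val ≤ ℓ ↔ (s ≤ v.val ∧ v.val ≤ s + ℓ) ∨ v.val + N ≤ s + ℓ := by
  have hv : v.val < N := ZMod.val_lt v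
  have hsval : ((s : ℕ) : ZMod N).val = s := ZMod.val_natCast_of_lt hs
  rcases le_or_gt s v.val with h | h
  · -- no wrap
    have hsv : ((s : ℕ) : ZMod N).val ≤ v.val := by rw [hsval]; exact h
    rw [ZMod.val_sub hsv, hsval]
    omega
  · -- wrap: `(v − s).val = v.val + N − s`
    have h1 : (v - (s : ZMod N)).val = v.val + N - s := by
      have e : v - (s : ZMod N) = ((v.val + N - s : ℕ) : ZMod N) := by
        have : ((v.val + N - s : ℕ) : ZMod N) + (s : ZMod N) = v := by
          rw [← Nat.cast_add, show v.val + N - s + s = v.val + N by omega, Nat.cast_add, ZMod.natCast_zmod_val, ZMod.natCast_self,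
            add_zero]
        exact sub_eq_of_eq_add this.symm
      rw [e, ZMod.val_natCast_of_lt (by omega)]
    rw [h1]
    omega

/-- ★ **CLOSED-BLOCK MEMBERSHIP**: `(v − start i).val ≤ len i ↔ (start i ≤ v.val ≤ start i + len i) ∨ (i is the last block ∧ v.val = 0)`. [folklore] -/
theorem memClosed_iff {N : ℕ} [NeZero N] (len start : Fin M → ℕ) (hlen : ∀ i, 1 ≤ len i)
    (hs : ∀ i j : Fin M, (j : ℕ) = (i : ℕ) + 1 → start j = start i + len i)
    (hl : ∀ i : Fin M, (i : ℕ) + 1 = M → start i + len i = N) (i : Fin M) (v : ZMod N) :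
    (v - ((start i : ℕ) : ZMod N)).val ≤ len i ↔ (start i ≤ v.val ∧ v.val ≤ start i + len i) ∨ ((i : ℕ) + 1 = M ∧ v.val = 0) := by
  have hsN : start i < N := by have := start_add_len_le len start hs hl i; have := hlen i; omega
  rw [val_sub_natCast_le_iff v hsN]
  have hle := start_add_len_le len start hs hl i
  constructor
  · rintro (h | h)
    · exact Or.inl h
    · right
      have hv0 : v.val = 0 := by omega
      refine ⟨?_, hv0⟩
      by_contra hne
      have := start_add_len_lt len start hs hlen hl i (by have := i.isLt; omega)
      omega
  · rintro (h | ⟨hi, hv⟩)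
    · exact Or.inl h
    · right
      rw [hv, hl i hi]
      omega

/-- `(v − s).val = v.val − s` when `s ≤ v.val`. [folklore] -/
theorem val_sub_natCast_of_le {N : ℕ} [NeZero N] (v : ZMod N) {s : ℕ} (h : s ≤ v.val) : (v - (s : ZMod N)).val = v.val - s := by
  have hs : s < N := lt_of_le_of_lt h (ZMod.val_lt v)
  have hsval : ((s : ℕ) : ZMod N).val = s := ZMod.val_natCast_of_lt hs
  rw [ZMod.val_sub (by rw [hsval]; exact h), hsval]

/-- `(v − s).val = v.val + N − s` when `v.val < s < N` (the wrap). [folklore] -/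
theorem val_sub_natCast_of_lt {N : ℕ} [NeZero N] (v : ZMod N) {s : ℕ} (hs : s < N) (h : v.val < s) : (v - (s : ZMod N)).val = v.val + N - s := by
  have e : v - (s : ZMod N) = ((v.val + N - s : ℕ) : ZMod N) := by
    have : ((v.val + N - s : ℕ) : ZMod N) + (s : ZMod N) = v := by
      rw [← Nat.cast_add, show v.val + N - s + s = v.val + N by omega, Nat.cast_add, ZMod.natCast_zmod_val, ZMod.natCast_self, add_zero]
    exact sub_eq_of_eq_add this.symm
  rw [e, ZMod.val_natCast_of_lt (by omega)]

/-! ## §3 Closed blocks meet only when consecutive, and then in the shared boundary -/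

section Adjacency
variable {N : ℕ} [NeZero N] (len start : Fin M → ℕ) (hlen : ∀ i, 1 ≤ len i)
  (hz : ∀ i : Fin M, (i : ℕ) = 0 → start i = 0)
  (hs : ∀ i j : Fin M, (j : ℕ) = (i : ℕ) + 1 → start j = start i + len i)
  (hl : ∀ i : Fin M, (i : ℕ) + 1 = M → start i + len i = N)

include hlen hs hl in
/-- ★★★ **(D0) CLOSED BLOCKS MEET ONLY WHEN CONSECUTIVE**: if `v` lies in the closed blocks `i ≠ i′` then `i′` is the successor of `i` or `i` of `i′` (cyclically:
«`Succ a b`» :≡ `b = a + 1 ∨ (a + 1 = M ∧ b = 0)`). [folklore] -/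
theorem adjacent_of_memClosed (i i' : Fin M) (v : ZMod N) (hne : i ≠ i')
    (hi : (v - ((start i : ℕ) : ZMod N)).val ≤ len i) (hi' : (v - ((start i' : ℕ) : ZMod N)).val ≤ len i') :
    ((i' : ℕ) = (i : ℕ) + 1 ∨ ((i : ℕ) + 1 = M ∧ (i' : ℕ) = 0)) ∨ ((i : ℕ) = (i' : ℕ) + 1 ∨ ((i' : ℕ) + 1 = M ∧ (i : ℕ) = 0)) := by
  have hne' : (i : ℕ) ≠ (i' : ℕ) := fun h => hne (Fin.ext h)
  rw [memClosed_iff len start hlen hs hl] at hi hi'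
  rcases hi with ⟨h1, h2⟩ | ⟨hiM, hv⟩ <;> rcases hi' with ⟨h1', h2'⟩ | ⟨hiM', hv'⟩
  · -- both plain: consecutive tiles
    rcases Nat.lt_or_gt_of_ne hne' with hlt | hgt
    · left; left
      by_contra hc
      have := start_add_len_lt_start len start hs hlen i i' (by omega)
      omega
    · right; left
      by_contra hc
      have := start_add_len_lt_start len start hs hlen i' i (by omega)
      omega
  · -- `i` plain, `i′` last with `v = 0`: then `start i = 0`, so `i = 0`
    right; right
    refine ⟨hiM', ?_⟩
    by_contra h0
    have := start_pos len start hs hlen i (by omega)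
    omega
  · left; right
    refine ⟨hiM, ?_⟩
    by_contra h0
    have := start_pos len start hs hlen i' (by omega)
    omega
  · exact absurd (by omega : (i : ℕ) = (i' : ℕ)) hne'

include hlen hz hs hl in
/-- ★★ **THE SHARED BOUNDARY**: if `i′` is the successor of `i` and `v` lies in both closed blocks, then `v` is the top of `i` and the bottom of `i′`:
`(v − start i).val = len i` and `(v − start i′).val = 0` (`3 ≤ M` excludes the degenerate two-block cycle). [folklore] -/
theorem boundary_of_succ_memClosed (hM : 3 ≤ M) (i i' : Fin M) (v : ZMod N) (hsucc : (i' : ℕ) = (i : ℕ) + 1 ∨ ((i : ℕ) + 1 = M ∧ (i' : ℕ) = 0))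
    (hi : (v - ((start i : ℕ) : ZMod N)).val ≤ len i) (hi' : (v - ((start i' : ℕ) : ZMod N)).val ≤ len i') :
    (v - ((start i : ℕ) : ZMod N)).val = len i ∧ (v - ((start i' : ℕ) : ZMod N)).val = 0 := by
  have hvN : v.val < N := ZMod.val_lt v
  have hle := start_add_len_le len start hs hl i
  have hle' := start_add_len_le len start hs hl i'
  have hsN : start i < N := by have := hlen i; omega
  have hsN' : start i' < N := by have := hlen i'; omega
  rw [memClosed_iff len start hlen hs hl] at hi hi'
  rcases hsucc with hs1 | ⟨hiM, hi0⟩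
  · -- plain successor: `start i′ = start i + len i`
    have hss : start i' = start i + len i := hs i i' hs1
    rcases hi with ⟨h1, h2⟩ | ⟨hiM, hv⟩
    · rcases hi' with ⟨h1', h2'⟩ | ⟨hiM', hv'⟩
      · have hv : v.val = start i + len i := by omega
        rw [val_sub_natCast_of_le v h1, val_sub_natCast_of_le v h1']
        omega
      · -- `i′` last and `v = 0` forces `start i = 0`, `i = 0`, `M = 2`
        exfalso
        have hs0 : start i = 0 := by omega
        have hi0 : (i : ℕ) = 0 := by
          by_contra h0
          have := start_pos len start hs hlen i (by omega)
          omega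
        omega
    · omega
  · -- wrap: `i` last, `i′ = 0`, `start i′ = 0`
    have hs0 : start i' = 0 := hz i' hi0
    have hsum : start i + len i = N := hl i hiM
    rcases hi' with ⟨h1', h2'⟩ | ⟨hiM', hv'⟩
    · rcases hi with ⟨h1, h2⟩ | ⟨_, hv⟩
      · -- `v ≥ start i ≥ start 1 + len 1 > len 0 ≥ v`: impossible for `M ≥ 3`
        exfalso
        have hM1 : 1 < M := by omega
        set i1 : Fin M := ⟨1, hM1⟩ with hi1
        have h01 : start i1 = start i' + len i' := hs i' i1 (show (1 : ℕ) = (i' : ℕ) + 1 by omega)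
        have h1i : start i1 + len i1 ≤ start i := start_add_len_le_start len start hs i1 i (show (1 : ℕ) < (i : ℕ) by omega)
        have hl1 : 1 ≤ len i1 := hlen i1
        omega
      · have hsp : 0 < start i := start_pos len start hs hlen i (by omega)
        rw [val_sub_natCast_of_lt v hsN (by rw [hv]; exact hsp), hv, hs0, Nat.cast_zero, sub_zero, hv]
        omega
    · omega

end Adjacency

/-! ## §4 Parity alternates around an even cycle; the descent agrees from both sides -/

/-- ★★ **PARITY ALTERNATES AROUND AN EVEN CYCLE**: if `j` is the (cyclic) successor of `i` and `M` is even, then `i` is odd iff `j` is even — wrap included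
(`M − 1` is odd). [folklore] -/
theorem odd_iff_succ_even (hEven : Even M) (i j : Fin M) (hsucc : (j : ℕ) = (i : ℕ) + 1 ∨ ((i : ℕ) + 1 = M ∧ (j : ℕ) = 0)) :
    (i : ℕ) % 2 = 1 ↔ (j : ℕ) % 2 = 0 := by
  obtain ⟨k, hk⟩ := hEven
  rcases hsucc with h | ⟨h1, h2⟩ <;> omega

/-- The cyclic successor is unique. [folklore] -/
theorem succ_unique (i j j' : Fin M) (h : (j : ℕ) = (i : ℕ) + 1 ∨ ((i : ℕ) + 1 = M ∧ (j : ℕ) = 0))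
    (h' : (j' : ℕ) = (i : ℕ) + 1 ∨ ((i : ℕ) + 1 = M ∧ (j' : ℕ) = 0)) : j = j' := by
  apply Fin.ext
  have := j.isLt; have := j'.isLt
  omega

/-- The cyclic predecessor is unique. [folklore] -/
theorem pred_unique (i j j' : Fin M) (h : (i : ℕ) = (j : ℕ) + 1 ∨ ((j : ℕ) + 1 = M ∧ (i : ℕ) = 0))
    (h' : (i : ℕ) = (j' : ℕ) + 1 ∨ ((j' : ℕ) + 1 = M ∧ (i : ℕ) = 0)) : j = j' := by
  apply Fin.ext
  have := j.isLt; have := j'.isLt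
  omega

section Descent
variable {N : ℕ} [NeZero N] (len start : Fin M → ℕ) (hlen : ∀ i, 1 ≤ len i)
  (hz : ∀ i : Fin M, (i : ℕ) = 0 → start i = 0)
  (hs : ∀ i j : Fin M, (j : ℕ) = (i : ℕ) + 1 → start j = start i + len i)
  (hl : ∀ i : Fin M, (i : ℕ) + 1 = M → start i + len i = N) (hM : 3 ≤ M) (hEven : Even M)

include hlen hz hs hl hM hEven in
/-- ★★★ **(D2) THE DESCENT AGREES FROM BOTH SIDES**: let `v` lie in the closed blocks `i` and `i′`; let `j` be the DESCENT of `v` from `i` — the predecessor of `i` if `i` is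
odd and `v` is the bottom of `i`, the successor of `i` if `i` is odd and `v` is the top of `i`, and `i` itself otherwise — and `j′` the descent from `i′`. Then `j = j′`
(consecutive blocks have opposite parity on an even cycle; the odd one descends onto the even one across the boundary `v` sits on). [folklore] -/
theorem descent_agrees (i i' j j' : Fin M) (v : ZMod N)
    (hi : (v - ((start i : ℕ) : ZMod N)).val ≤ len i) (hi' : (v - ((start i' : ℕ) : ZMod N)).val ≤ len i')
    (hj : ((i : ℕ) % 2 = 1 ∧ (v - ((start i : ℕ) : ZMod N)).val = 0 ∧ ((i : ℕ) = (j : ℕ) + 1 ∨ ((j : ℕ) + 1 = M ∧ (i : ℕ) = 0))) ∨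
      ((i : ℕ) % 2 = 1 ∧ (v - ((start i : ℕ) : ZMod N)).val = len i ∧ ((j : ℕ) = (i : ℕ) + 1 ∨ ((i : ℕ) + 1 = M ∧ (j : ℕ) = 0))) ∨
      (¬ ((i : ℕ) % 2 = 1 ∧ ((v - ((start i : ℕ) : ZMod N)).val = 0 ∨ (v - ((start i : ℕ) : ZMod N)).val = len i)) ∧ j = i))
    (hj' : ((i' : ℕ) % 2 = 1 ∧ (v - ((start i' : ℕ) : ZMod N)).val = 0 ∧ ((i' : ℕ) = (j' : ℕ) + 1 ∨ ((j' : ℕ) + 1 = M ∧ (i' : ℕ) = 0))) ∨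
      ((i' : ℕ) % 2 = 1 ∧ (v - ((start i' : ℕ) : ZMod N)).val = len i' ∧ ((j' : ℕ) = (i' : ℕ) + 1 ∨ ((i' : ℕ) + 1 = M ∧ (j' : ℕ) = 0))) ∨
      (¬ ((i' : ℕ) % 2 = 1 ∧ ((v - ((start i' : ℕ) : ZMod N)).val = 0 ∨ (v - ((start i' : ℕ) : ZMod N)).val = len i')) ∧ j' = i')) :
    j = j' := by
  have hℓ := hlen i
  have hℓ' := hlen i'
  by_cases hii : i = i'
  · -- same block: the descent relation is functional
    subst hii
    rcases hj with ⟨ho, hv0, hp⟩ | ⟨ho, hvl, hsu⟩ | ⟨hno, hji⟩ <;> rcases hj' with ⟨ho', hv0', hp'⟩ | ⟨ho', hvl', hsu'⟩ | ⟨hno', hji'⟩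
    · exact pred_unique i j j' hp hp'
    · omega
    · exact absurd ⟨ho, Or.inl hv0⟩ hno'
    · omega
    · exact succ_unique i j j' hsu hsu'
    · exact absurd ⟨ho, Or.inr hvl⟩ hno'
    · exact absurd ⟨ho', Or.inl hv0'⟩ hno
    · exact absurd ⟨ho', Or.inr hvl'⟩ hno
    · rw [hji, hji']
  · -- consecutive blocks: the odd one descends onto the even one
    rcases adjacent_of_memClosed len start hlen hs hl i i' v hii hi hi' with hsucc | hsucc
    · -- `i′` is the successor of `i`
      obtain ⟨hbi, hbi'⟩ := boundary_of_succ_memClosed len start hlen hz hs hl hM i i' v hsucc hi hi'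
      have hpar := odd_iff_succ_even hEven i i' hsucc
      by_cases ho : (i : ℕ) % 2 = 1
      · -- `i` odd: `j = succ i = i′`, and `i′` even: `j′ = i′`
        have he' : ¬ (i' : ℕ) % 2 = 1 := by omega
        have hjj : j = i' := by
          rcases hj with ⟨_, hv0, _⟩ | ⟨_, _, hsu⟩ | ⟨hno, _⟩
          · omega
          · exact succ_unique i j i' hsu hsucc
          · exact absurd ⟨ho, Or.inr hbi⟩ hno
        have hjj' : j' = i' := by
          rcases hj' with ⟨ho', _, _⟩ | ⟨ho', _, _⟩ | ⟨_, hji'⟩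
          · exact absurd ho' he'
          · exact absurd ho' he'
          · exact hji'
        rw [hjj, hjj']
      · -- `i` even: `j = i`, and `i′` odd with `v` at its bottom: `j′ = pred i′ = i`
        have ho' : (i' : ℕ) % 2 = 1 := by omega
        have hjj : j = i := by
          rcases hj with ⟨ho2, _, _⟩ | ⟨ho2, _, _⟩ | ⟨_, hji⟩
          · exact absurd ho2 ho
          · exact absurd ho2 ho
          · exact hji
        have hjj' : j' = i := by
          rcases hj' with ⟨_, _, hp'⟩ | ⟨_, hvl', _⟩ | ⟨hno', _⟩
          · exact pred_unique i' j' i hp' (by rcases hsucc with h | ⟨h1, h2⟩ <;> omega)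
          · omega
          · exact absurd ⟨ho', Or.inl hbi'⟩ hno'
        rw [hjj, hjj']
    · -- `i` is the successor of `i′`: the mirror image
      obtain ⟨hbi', hbi⟩ := boundary_of_succ_memClosed len start hlen hz hs hl hM i' i v hsucc hi' hi
      have hpar := odd_iff_succ_even hEven i' i hsucc
      by_cases ho' : (i' : ℕ) % 2 = 1
      · have he : ¬ (i : ℕ) % 2 = 1 := by omega
        have hjj' : j' = i := by
          rcases hj' with ⟨_, hv0', _⟩ | ⟨_, _, hsu'⟩ | ⟨hno', _⟩
          · omega
          · exact succ_unique i' j' i hsu' hsucc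
          · exact absurd ⟨ho', Or.inr hbi'⟩ hno'
        have hjj : j = i := by
          rcases hj with ⟨ho, _, _⟩ | ⟨ho, _, _⟩ | ⟨_, hji⟩
          · exact absurd ho he
          · exact absurd ho he
          · exact hji
        rw [hjj, hjj']
      · have ho : (i : ℕ) % 2 = 1 := by omega
        have hjj' : j' = i' := by
          rcases hj' with ⟨ho2, _, _⟩ | ⟨ho2, _, _⟩ | ⟨_, hji'⟩
          · exact absurd ho2 ho'
          · exact absurd ho2 ho'
          · exact hji'
        have hjj : j = i' := by
          rcases hj with ⟨_, _, hp⟩ | ⟨_, hvl, _⟩ | ⟨hno, _⟩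
          · exact pred_unique i j i' hp (by rcases hsucc with h | ⟨h1, h2⟩ <;> omega)
          · omega
          · exact absurd ⟨ho, Or.inl hbi⟩ hno
        rw [hjj, hjj']

end Descent

end Summit.QuantumFields.YangMills.Theorems.FluctuationComparisonRegPrIntLS2BetaParityDescent
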